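import Literature.NumberTheory.Sieve.Maynard2016ReductionProof
import Literature.NumberTheory.Sieve.SingularProductAverages
import Literature.NumberTheory.LFunctions.MertensFormula
import HarnessLib

/-!
# Maynard 2016, §2: PROOF of Lemma 4 from Lemma 3 (`Maynard2016.Lemma4` ⇐ `Maynard2016.Lemma3`)

Topic `Literature/NumberTheory/Sieve`. Everything in this file is PROVED. It derives the named fact
`Maynard2016.Lemma4` (the two "in particular" bounds
`Σ_{U/(z (log₂ x)²) ≤ m < U/z} |𝓡_m| = o(x/log x)` and `Σ_{1 ≤ m < U/(z (log₂ x)²)} |𝓡_m| =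
O(C_U x/log x)`) from the named fact `Maynard2016.Lemma3` (the fundamental-lemma/Bombieri–Vinogradov
count of `{z < p ≤ V : (mp − 1, P_y) = 1}`, first display, as typed), Mertens' product theorem
(tree: `Mertens.abs_prod_one_sub_inv_mul_log_sub_one_le`) and the elementary average of the odd
singular product (`SingularProductAverages.lean`), following the printed proof:

  "Proof [of Lemma 4]. This follows from Lemma 3, and the bound
  `Σ_{U/(zM) ≤ m < U/z, 2 | m} (1/m) ∏_{p | m, p > 2} (p−1)/(p−2) ≪ log M`."

Steps. `card_Rm_le`: from Lemma 3 at `V = max(U/m, z + z/log x)` (monotonicity of the sieved set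
in `V`), `|𝓡_m| ≤ 2·𝔖_y(m)·(U/(m log x) + z/log² x)` where `𝔖_y(m) = ∏_{p ≤ y, p ∤ m}(p−2)/(p−1)`
(`singProd`); `singProd_le_oddPrimeProd_mul`: `𝔖_y(m) ≤ P_y · g(m)` with
`P_y = ∏_{2 < p ≤ y}(p−2)/(p−1)` and `g(m) = ∏_{p|m, p>2}(p−1)/(p−2)` (`oddSingProd`; `= 0` for odd
`m`); `oddPrimeProd_le`: `P_y ≤ 6/log y` (Mertens); `sum_card_Rm_le`: the sum over any set of
`m ∈ [A, B)` is `≤ (2 P_y U/log x)(4 log(B/A)/log 2 + 4) + 4 P_y z B/log² x`; then the two ranges with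
`A = ⌈U z⁻¹(log₂x)⁻²⌉`, `B = ⌈U/z⌉` (tail: `log(B/A) ≤ log 2 + 2 log₃ x`, total
`≤ 384 C_U (1 + log₃ x)/log₂ x · x/log x = o(x/log x)`) and `A = 1`, `B = ⌈U z⁻¹(log₂x)⁻²⌉` (head:
`≤ (576 + 192|log C_U|)·C_U x/log x`).

## References

* J. Maynard, *Large gaps between primes*, Ann. of Math. (2) 183 (2016), 915–933; arXiv:1408.5110,
  §2, Lemmas 3–4. [Maynard2016LargeGaps]
* G. H. Hardy, E. M. Wright, *An Introduction to the Theory of Numbers*, 6th ed., Thm 429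
  (Mertens). [HardyWright2008]
-/

open Filter Finset
open scoped Topology

namespace Literature.NumberTheory.Sieve

namespace Maynard2016

open SingularProductAverage

/-! ### `𝔖_y(m) ≤ P_y · g(m)` and Mertens for `P_y` -/

/-- `P_Y = ∏_{2 < p ≤ Y, p prime} (p − 2)/(p − 1)`. [cite: Maynard2016LargeGaps, §2, Lemma 3
(second display: `2e^{−γ}/log y · ∏_{p>2} p(p−2)/(p−1)²` is its asymptotic)] -/
noncomputable def oddPrimeProd (Y : ℕ) : ℝ :=
  ∏ p ∈ (Finset.Iic Y).filter (fun p => p.Prime ∧ 2 < p), (((p : ℝ) - 2) / ((p : ℝ) - 1))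

/-- `P_Y > 0`. [cite: Maynard2016LargeGaps, §2, Lemma 3] -/
theorem oddPrimeProd_pos (Y : ℕ) : 0 < oddPrimeProd Y :=
  prod_pos fun p hp => by
    have h3 : (3 : ℝ) ≤ p := by exact_mod_cast (mem_filter.1 hp).2.2
    exact div_pos (by linarith) (by linarith)

/-- `𝔖_y(m) ≥ 0`. [cite: Maynard2016LargeGaps, §2, Lemma 3] -/
theorem singProd_nonneg (ε : ℝ) (x m : ℕ) : 0 ≤ singProd ε x m :=
  prod_nonneg fun p hp => by
    have h2 : (2 : ℝ) ≤ p := by exact_mod_cast (mem_filter.1 hp).2.1.two_le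
    exact div_nonneg (by linarith) (by linarith)

/-- **`𝔖_y(m) ≤ P_y · g(m)`** (`m ≥ 1`, `y ≥ 2`): for even `m`,
`∏_{p≤y, p∤m}(p−2)/(p−1) = P_y · ∏_{2<p≤y, p|m}(p−1)/(p−2) ≤ P_y g(m)`; for odd `m` the factor
`p = 2` makes `𝔖_y(m) = 0`. [cite: Maynard2016LargeGaps, §2, Lemma 3 (second display)] -/
theorem singProd_le_oddPrimeProd_mul {ε : ℝ} {x m : ℕ} (hm : 1 ≤ m) (hY : 2 ≤ ⌊y ε x⌋₊) :
    singProd ε x m ≤ oddPrimeProd ⌊y ε x⌋₊ * oddSingProd m := by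
  classical
  rcases Nat.even_or_odd m with hev | hodd
  · set O : Finset ℕ := (Finset.Iic ⌊y ε x⌋₊).filter (fun p => p.Prime ∧ 2 < p) with hO
    have hsing : singProd ε x m =
        ∏ p ∈ O.filter (fun p => ¬ p ∣ m), (((p : ℝ) - 2) / ((p : ℝ) - 1)) := by
      rw [singProd]
      refine prod_congr ?_ fun _ _ => rfl
      ext p
      simp only [hO, mem_filter, mem_Iic]
      constructor
      · rintro ⟨hpY, hp, hpm⟩
        refine ⟨⟨hpY, hp, lt_of_le_of_ne hp.two_le ?_⟩, hpm⟩
        rintro rfl; exact hpm (even_iff_two_dvd.1 hev)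
      · rintro ⟨⟨hpY, hp, -⟩, hpm⟩; exact ⟨hpY, hp, hpm⟩
    have hsplit : (∏ p ∈ O.filter (fun p => p ∣ m), (((p : ℝ) - 2) / ((p : ℝ) - 1))) *
        ∏ p ∈ O.filter (fun p => ¬ p ∣ m), (((p : ℝ) - 2) / ((p : ℝ) - 1)) =
          oddPrimeProd ⌊y ε x⌋₊ := by
      rw [oddPrimeProd, ← hO]; exact prod_filter_mul_prod_filter_not O (fun p => p ∣ m) _
    have hfac : ∀ p ∈ O, (0 : ℝ) < ((p : ℝ) - 2) / ((p : ℝ) - 1) ∧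
        ((p : ℝ) - 2) / ((p : ℝ) - 1) ≤ 1 := by
      intro p hp
      have h3 : (3 : ℝ) ≤ p := by exact_mod_cast (mem_filter.1 hp).2.2
      exact ⟨div_pos (by linarith) (by linarith), by rw [div_le_one (by linarith)]; linarith⟩
    have hD0 : 0 < ∏ p ∈ O.filter (fun p => p ∣ m), (((p : ℝ) - 2) / ((p : ℝ) - 1)) :=
      prod_pos fun p hp => (hfac p (mem_filter.1 hp).1).1
    -- `D⁻¹ = ∏_{2<p≤y, p|m} (p−1)/(p−2) ≤ g(m)`
    have hDinv : (∏ p ∈ O.filter (fun p => p ∣ m), (((p : ℝ) - 2) / ((p : ℝ) - 1)))⁻¹ ≤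
        oddSingProd m := by
      rw [← prod_inv_distrib]
      have hsub : O.filter (fun p => p ∣ m) ⊆ m.primeFactors.filter (fun p => 2 < p) := by
        intro p hp
        rw [mem_filter] at hp ⊢
        have hp' := mem_filter.1 hp.1
        exact ⟨Nat.mem_primeFactors.2 ⟨hp'.2.1, hp.2, by omega⟩, hp'.2.2⟩
      have hge1 : ∀ p ∈ m.primeFactors.filter (fun p => 2 < p),
          (1 : ℝ) ≤ ((p : ℝ) - 1) / ((p : ℝ) - 2) := by
        intro p hp
        have h3 : (3 : ℝ) ≤ p := by exact_mod_cast (mem_filter.1 hp).2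
        rw [le_div_iff₀ (by linarith)]; linarith
      have hrest : (1 : ℝ) ≤ ∏ p ∈ m.primeFactors.filter (fun p => 2 < p) \ O.filter (fun p => p ∣ m),
          (((p : ℝ) - 1) / ((p : ℝ) - 2)) := by
        have h := prod_le_prod (s := m.primeFactors.filter (fun p => 2 < p) \ O.filter (fun p => p ∣ m))
          (fun _ _ => zero_le_one) fun p hp => hge1 p (mem_sdiff.1 hp).1
        simpa using h
      have hS0 : (0 : ℝ) ≤ ∏ p ∈ O.filter (fun p => p ∣ m), (((p : ℝ) - 1) / ((p : ℝ) - 2)) :=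
        prod_nonneg fun p hp => le_trans zero_le_one (hge1 p (hsub hp))
      calc ∏ p ∈ O.filter (fun p => p ∣ m), ((((p : ℝ) - 2) / ((p : ℝ) - 1)))⁻¹
          = ∏ p ∈ O.filter (fun p => p ∣ m), (((p : ℝ) - 1) / ((p : ℝ) - 2)) :=
            prod_congr rfl fun p _ => by rw [inv_div]
        _ ≤ (∏ p ∈ m.primeFactors.filter (fun p => 2 < p) \ O.filter (fun p => p ∣ m),
              (((p : ℝ) - 1) / ((p : ℝ) - 2))) *
            ∏ p ∈ O.filter (fun p => p ∣ m), (((p : ℝ) - 1) / ((p : ℝ) - 2)) :=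
            le_mul_of_one_le_left hS0 hrest
        _ = oddSingProd m := by rw [oddSingProd, prod_sdiff hsub]
    have heq : singProd ε x m = oddPrimeProd ⌊y ε x⌋₊ *
        (∏ p ∈ O.filter (fun p => p ∣ m), (((p : ℝ) - 2) / ((p : ℝ) - 1)))⁻¹ := by
      rw [hsing, ← hsplit]
      field_simp
    rw [heq]
    exact mul_le_mul_of_nonneg_left hDinv (oddPrimeProd_pos _).le
  · have h0 : singProd ε x m = 0 := by
      apply prod_eq_zero (i := 2)
      · rw [mem_filter, mem_Iic]
        refine ⟨hY, Nat.prime_two, fun h2 => ?_⟩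
        have := Nat.odd_iff.1 hodd; omega
      · norm_num
    rw [h0]
    exact mul_nonneg (oddPrimeProd_pos _).le (oddSingProd_nonneg m)

/-- **Mertens for `P_Y`: `P_Y ≤ 6/log Y`** once `log Y ≥ 12` ((p−2)/(p−1) ≤ 1 − 1/p, the factor
`p = 2` of Mertens' product is `1/2`, and `∏_{p≤Y}(1−1/p) ≤ 3/(e^γ log Y)`).
[cite: HardyWright2008, Thm 429; Maynard2016LargeGaps, §2, Lemma 3 («using Mertens' theorem»)] -/
theorem oddPrimeProd_le {Y : ℕ} (hY : Real.exp 12 ≤ Y) : oddPrimeProd Y ≤ 6 / Real.log Y := by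
  classical
  have hY1 : (1 : ℝ) < Y := lt_of_lt_of_le (by have := Real.add_one_le_exp (12 : ℝ); linarith) hY
  have hlogY : 12 ≤ Real.log Y := by
    have := Real.log_le_log (Real.exp_pos 12) hY; rwa [Real.log_exp] at this
  have hlog0 : 0 < Real.log Y := by linarith
  have hY2 : (2 : ℝ) ≤ Y := by
    have := Real.add_one_le_exp (12 : ℝ); linarith
  -- Mertens
  have hM := Literature.NumberTheory.LFunctions.Mertens.abs_prod_one_sub_inv_mul_log_sub_one_le hY2
    hlogY
  rw [Nat.floor_natCast] at hM
  have hγ1 : 1 ≤ Real.exp Real.eulerMascheroniConstant := by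
    have := Real.add_one_le_exp Real.eulerMascheroniConstant
    have h0 : 0 ≤ Real.eulerMascheroniConstant := by
      have := Real.one_half_lt_eulerMascheroniConstant; linarith
    linarith
  have hall : ∏ p ∈ Nat.primesLE Y, (1 - (p : ℝ)⁻¹) ≤ 3 / Real.log Y := by
    have h1 := (abs_le.1 hM).2
    have h24 : 24 / Real.log Y ≤ 2 := by rw [div_le_iff₀ hlog0]; linarith
    have hP0 : 0 ≤ ∏ p ∈ Nat.primesLE Y, (1 - (p : ℝ)⁻¹) :=
      prod_nonneg fun p hp => by
        have h2 : (2 : ℝ) ≤ p := by exact_mod_cast (Nat.mem_primesLE.1 hp).2.two_le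
        have : (p : ℝ)⁻¹ ≤ 1 / 2 := by rw [inv_eq_one_div]; exact div_le_div_of_nonneg_left zero_le_one two_pos h2
        linarith
    rw [le_div_iff₀ hlog0]
    have h2 : (∏ p ∈ Nat.primesLE Y, (1 - (p : ℝ)⁻¹)) * Real.log Y ≤
        (∏ p ∈ Nat.primesLE Y, (1 - (p : ℝ)⁻¹)) * (Real.exp Real.eulerMascheroniConstant * Real.log Y) := by
      have : Real.log Y ≤ Real.exp Real.eulerMascheroniConstant * Real.log Y :=
        le_mul_of_one_le_left hlog0.le hγ1
      exact mul_le_mul_of_nonneg_left this hP0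
    linarith
  -- remove the factor `p = 2`
  set O : Finset ℕ := (Finset.Iic Y).filter (fun p => p.Prime ∧ 2 < p) with hO
  have hY2n : 2 ≤ Y := by exact_mod_cast hY2
  have hins : Nat.primesLE Y = insert 2 O := by
    ext p
    rw [Nat.mem_primesLE, mem_insert, hO, mem_filter, mem_Iic]
    constructor
    · rintro ⟨hpY, hp⟩
      rcases eq_or_lt_of_le hp.two_le with h | h
      · exact Or.inl h.symm
      · exact Or.inr ⟨hpY, hp, h⟩
    · rintro (rfl | ⟨hpY, hp, -⟩)
      · exact ⟨hY2n, Nat.prime_two⟩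
      · exact ⟨hpY, hp⟩
  have h2O : (2 : ℕ) ∉ O := by rw [hO, mem_filter]; omega
  rw [hins, prod_insert h2O] at hall
  have hle : oddPrimeProd Y ≤ ∏ p ∈ O, (1 - (p : ℝ)⁻¹) := by
    rw [oddPrimeProd, ← hO]
    refine prod_le_prod (fun p hp => ?_) fun p hp => ?_
    · have h3 : (3 : ℝ) ≤ p := by exact_mod_cast (mem_filter.1 hp).2.2
      exact div_nonneg (by linarith) (by linarith)
    · have h3 : (3 : ℝ) ≤ p := by exact_mod_cast (mem_filter.1 hp).2.2
      rw [div_le_iff₀ (by linarith), inv_eq_one_div]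
      field_simp
      nlinarith
  have h3 : ∏ p ∈ O, (1 - (p : ℝ)⁻¹) ≤ 6 / Real.log Y := by
    norm_num at hall
    have : (6 : ℝ) / Real.log Y = 2 * (3 / Real.log Y) := by ring
    rw [this]; linarith
  exact hle.trans h3

/-! ### `|𝓡_m|` pointwise, from Lemma 3 -/

/-- **`|𝓡_m| ≤ 2 𝔖_y(m) (U/(m log x) + z/log² x)`** from Lemma 3 (relative error `κ ≤ 1`) at
`V = U/m` if `U/m ≥ z + z/log x`, else at `V = z + z/log x` by monotonicity of the sieved set in
`V`. [cite: Maynard2016LargeGaps, §2, Lemma 3 ⇒ Lemma 4] -/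
theorem card_Rm_le {C_U ε κ : ℝ} {x m : ℕ} (hκ0 : 0 ≤ κ) (hκ : κ ≤ 1) (hz0 : 0 ≤ z x)
    (hlog : 0 < Real.log x) (hm : 1 ≤ m) (hmx : m ≤ x) (hU0 : 0 ≤ U C_U ε x)
    (hUx : U C_U ε x ≤ (x : ℝ) * Real.log x ^ 2)
    (hV₀x : z x + z x / Real.log x ≤ (x : ℝ) * Real.log x ^ 2)
    (hL3 : ∀ V : ℝ, z x + z x / Real.log x ≤ V → V ≤ (x : ℝ) * Real.log x ^ 2 →
      ∀ m : ℕ, 1 ≤ m → m ≤ x →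
        |((sievedPrimes ε x V m).card : ℝ) - (V - z x) / Real.log x * singProd ε x m| ≤
          κ * ((V - z x) / Real.log x * singProd ε x m)) :
    ((Rm C_U ε x m).card : ℝ) ≤
      2 * singProd ε x m * (U C_U ε x / m / Real.log x + z x / Real.log x ^ 2) := by
  have hs0 := singProd_nonneg ε x m
  have hzl : 0 ≤ z x / Real.log x := div_nonneg hz0 hlog.le
  have hzl2 : 0 ≤ z x / Real.log x ^ 2 := by positivity
  have hm0 : (0 : ℝ) < m := by exact_mod_cast hm
  have key : ∀ V : ℝ, z x + z x / Real.log x ≤ V → V ≤ (x : ℝ) * Real.log x ^ 2 →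
      ((sievedPrimes ε x V m).card : ℝ) ≤ 2 * ((V - z x) / Real.log x * singProd ε x m) := by
    intro V h1 h2
    have h := (abs_le.1 (hL3 V h1 h2 m hm hmx)).2
    have hmain0 : 0 ≤ (V - z x) / Real.log x * singProd ε x m := by
      have : 0 ≤ V - z x := by linarith
      positivity
    nlinarith
  rcases le_or_gt (z x + z x / Real.log x) (U C_U ε x / m) with hV | hV
  · have hUm : U C_U ε x / m ≤ (x : ℝ) * Real.log x ^ 2 :=
      (div_le_self hU0 (by exact_mod_cast hm)).trans hUx
    have h := key _ hV hUm
    rw [Rm]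
    have h2 : (U C_U ε x / m - z x) / Real.log x ≤ U C_U ε x / m / Real.log x :=
      div_le_div_of_nonneg_right (by linarith) hlog.le
    have h3 : (U C_U ε x / m - z x) / Real.log x * singProd ε x m ≤
        U C_U ε x / m / Real.log x * singProd ε x m := mul_le_mul_of_nonneg_right h2 hs0
    nlinarith
  · have hsub : Rm C_U ε x m ⊆ sievedPrimes ε x (z x + z x / Real.log x) m := by
      rw [Rm]
      intro p hp
      rw [sievedPrimes, mem_filter, mem_Icc] at hp ⊢
      exact ⟨⟨hp.1.1, hp.1.2.trans (Nat.floor_le_floor hV.le)⟩, hp.2⟩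
    have h := key _ le_rfl hV₀x
    have heq : (z x + z x / Real.log x - z x) / Real.log x = z x / Real.log x ^ 2 := by
      field_simp
      ring
    rw [heq] at h
    have h1 : ((Rm C_U ε x m).card : ℝ) ≤ ((sievedPrimes ε x (z x + z x / Real.log x) m).card : ℝ) := by
      exact_mod_cast card_le_card hsub
    have h4 : 0 ≤ U C_U ε x / m / Real.log x := by positivity
    nlinarith

/-! ### The sum over a range of `m` -/

/-- **`Σ_{m ∈ S} |𝓡_m| ≤ (2 P_y U/log x)(4 log(B/A)/log 2 + 4) + 4 P_y z B/log² x`** for any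
`S ⊆ [A, B)` with `1 ≤ A ≤ B`, `B ≤ x` (pointwise bound, `𝔖_y ≤ P_y g`, and the dyadic average of `g`).
[cite: Maynard2016LargeGaps, §2, proof of Lemma 4] -/
theorem sum_card_Rm_le {C_U ε κ : ℝ} {x A B : ℕ} (S : Finset ℕ) (hS : S ⊆ Finset.Ico A B)
    (hA : 1 ≤ A) (hAB : A ≤ B) (hBx : B ≤ x)
    (hκ0 : 0 ≤ κ) (hκ : κ ≤ 1) (hz0 : 0 ≤ z x) (hlog : 0 < Real.log x) (hU0 : 0 ≤ U C_U ε x)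
    (hY : 2 ≤ ⌊y ε x⌋₊)
    (hUx : U C_U ε x ≤ (x : ℝ) * Real.log x ^ 2)
    (hV₀x : z x + z x / Real.log x ≤ (x : ℝ) * Real.log x ^ 2)
    (hL3 : ∀ V : ℝ, z x + z x / Real.log x ≤ V → V ≤ (x : ℝ) * Real.log x ^ 2 →
      ∀ m : ℕ, 1 ≤ m → m ≤ x →
        |((sievedPrimes ε x V m).card : ℝ) - (V - z x) / Real.log x * singProd ε x m| ≤
          κ * ((V - z x) / Real.log x * singProd ε x m)) :
    (∑ m ∈ S, ((Rm C_U ε x m).card : ℝ)) ≤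
      2 * oddPrimeProd ⌊y ε x⌋₊ * U C_U ε x / Real.log x *
          (4 * (Real.log B - Real.log A) / Real.log 2 + 4) +
        4 * oddPrimeProd ⌊y ε x⌋₊ * z x * B / Real.log x ^ 2 := by
  have hP := (oddPrimeProd_pos ⌊y ε x⌋₊).le
  -- pointwise
  have hpt : ∀ m ∈ S, ((Rm C_U ε x m).card : ℝ) ≤
      2 * oddPrimeProd ⌊y ε x⌋₊ * U C_U ε x / Real.log x * (oddSingProd m / m) +
        2 * oddPrimeProd ⌊y ε x⌋₊ * z x / Real.log x ^ 2 * oddSingProd m := by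
    intro m hm
    have hm' := mem_Ico.1 (hS hm)
    have hm1 : 1 ≤ m := hA.trans hm'.1
    have hmx : m ≤ x := (hm'.2.le.trans hBx)
    have h1 := card_Rm_le hκ0 hκ hz0 hlog hm1 hmx hU0 hUx hV₀x hL3
    have h2 := singProd_le_oddPrimeProd_mul (ε := ε) (x := x) hm1 hY
    have h3 : 0 ≤ U C_U ε x / m / Real.log x + z x / Real.log x ^ 2 := by positivity
    have h4 : 2 * singProd ε x m * (U C_U ε x / m / Real.log x + z x / Real.log x ^ 2) ≤
        2 * (oddPrimeProd ⌊y ε x⌋₊ * oddSingProd m) *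
          (U C_U ε x / m / Real.log x + z x / Real.log x ^ 2) :=
      mul_le_mul_of_nonneg_right (mul_le_mul_of_nonneg_left h2 zero_le_two) h3
    have h5 : 2 * (oddPrimeProd ⌊y ε x⌋₊ * oddSingProd m) *
          (U C_U ε x / m / Real.log x + z x / Real.log x ^ 2) =
        2 * oddPrimeProd ⌊y ε x⌋₊ * U C_U ε x / Real.log x * (oddSingProd m / m) +
          2 * oddPrimeProd ⌊y ε x⌋₊ * z x / Real.log x ^ 2 * oddSingProd m := by
      ring
    linarith
  -- sum
  have hsum1 : (∑ m ∈ S, oddSingProd m / m) ≤ 4 * (Real.log B - Real.log A) / Real.log 2 + 4 :=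
    (sum_le_sum_of_subset_of_nonneg hS fun m _ _ =>
      div_nonneg (oddSingProd_nonneg m) (Nat.cast_nonneg m)).trans (sum_Ico_oddSingProd_div_le hA hAB)
  have hsum2 : (∑ m ∈ S, oddSingProd m) ≤ 2 * B := by
    have hS' : S ⊆ Finset.Ioc 0 B := by
      intro m hm
      have := mem_Ico.1 (hS hm)
      rw [mem_Ioc]; omega
    exact (sum_le_sum_of_subset_of_nonneg hS' fun m _ _ => oddSingProd_nonneg m).trans
      (sum_oddSingProd_le B)
  have hc1 : 0 ≤ 2 * oddPrimeProd ⌊y ε x⌋₊ * U C_U ε x / Real.log x := by positivity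
  have hc2 : 0 ≤ 2 * oddPrimeProd ⌊y ε x⌋₊ * z x / Real.log x ^ 2 := by positivity
  calc (∑ m ∈ S, ((Rm C_U ε x m).card : ℝ))
      ≤ ∑ m ∈ S, (2 * oddPrimeProd ⌊y ε x⌋₊ * U C_U ε x / Real.log x * (oddSingProd m / m) +
          2 * oddPrimeProd ⌊y ε x⌋₊ * z x / Real.log x ^ 2 * oddSingProd m) := sum_le_sum hpt
    _ = 2 * oddPrimeProd ⌊y ε x⌋₊ * U C_U ε x / Real.log x * ∑ m ∈ S, oddSingProd m / m +
          2 * oddPrimeProd ⌊y ε x⌋₊ * z x / Real.log x ^ 2 * ∑ m ∈ S, oddSingProd m := by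
        rw [sum_add_distrib, mul_sum, mul_sum]
    _ ≤ 2 * oddPrimeProd ⌊y ε x⌋₊ * U C_U ε x / Real.log x *
          (4 * (Real.log B - Real.log A) / Real.log 2 + 4) +
        2 * oddPrimeProd ⌊y ε x⌋₊ * z x / Real.log x ^ 2 * (2 * B) :=
        add_le_add (mul_le_mul_of_nonneg_left hsum1 hc1) (mul_le_mul_of_nonneg_left hsum2 hc2)
    _ = _ := by ring

/-! ### Growth bookkeeping for all large `x` -/

/-- `log t ≤ t/2` for `t > 0`. [folklore] -/
private theorem log_le_half' {t : ℝ} (ht : 0 < t) : Real.log t ≤ t / 2 := by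
  have h1 := Real.log_le_sub_one_of_pos (half_pos ht)
  have h2 : Real.log (t / 2) = Real.log t - Real.log 2 := Real.log_div ht.ne' two_ne_zero
  have h3 : Real.log 2 < 1 := by have := Real.log_two_lt_d9; norm_num at this; linarith
  linarith

/-- Real-variable growth facts transferred to `x : ℕ`. [folklore] -/
private theorem eventually_logs {C_U K : ℝ} (hC : 0 < C_U) :
    ∀ᶠ x : ℕ in atTop,
      1 ≤ Real.log x ∧ 4 ≤ Real.log (Real.log x) ∧ Real.log K ^ 2 ≤ Real.log (Real.log x) ∧
      C_U ≤ Real.log x ∧ 8 ≤ (x : ℝ) ∧ C_U * Real.log x + 1 ≤ (x : ℝ) / 4 ∧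
      Real.log (Real.log x) ≤ Real.log x / 32 ∧
      2 * Real.log (Real.log x) ^ 3 ≤ C_U * Real.log x := by
  have hT₂ : Tendsto (fun X : ℝ => Real.log (Real.log X)) atTop atTop :=
    Real.tendsto_log_atTop.comp Real.tendsto_log_atTop
  have hlin := Real.isLittleO_log_id_atTop.bound (show (0 : ℝ) < 1 / (8 * C_U) by positivity)
  have hlin32 := Real.tendsto_log_atTop.eventually
    (Real.isLittleO_log_id_atTop.bound (show (0 : ℝ) < 1 / 32 by norm_num))
  have hcube := Real.tendsto_log_atTop.eventually
    ((isLittleO_log_rpow_rpow_atTop 3 one_pos).bound (show (0 : ℝ) < C_U / 2 by positivity))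
  have hreal : ∀ᶠ X : ℝ in atTop, 1 ≤ Real.log X ∧ 4 ≤ Real.log (Real.log X) ∧
      Real.log K ^ 2 ≤ Real.log (Real.log X) ∧
      C_U ≤ Real.log X ∧ 8 ≤ X ∧ C_U * Real.log X + 1 ≤ X / 4 ∧
      Real.log (Real.log X) ≤ Real.log X / 32 ∧
      2 * Real.log (Real.log X) ^ 3 ≤ C_U * Real.log X := by
    filter_upwards [hT₂.eventually_ge_atTop 4, hT₂.eventually_ge_atTop (Real.log K ^ 2), hlin,
      eventually_ge_atTop (8 : ℝ), Real.tendsto_log_atTop.eventually_ge_atTop 1,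
      Real.tendsto_log_atTop.eventually_ge_atTop C_U, hlin32, hcube]
      with X h4 hK2 hlinX hX8 hlog1 hlogC hlin32X hcubeX
    refine ⟨hlog1, h4, hK2, hlogC, hX8, ?_, ?_, ?_⟩
    · rw [Real.norm_eq_abs, Real.norm_eq_abs, id, abs_of_nonneg (by linarith),
        abs_of_nonneg (by linarith)] at hlinX
      have : C_U * Real.log X ≤ X / 8 := by
        have h := mul_le_mul_of_nonneg_left hlinX hC.le
        calc C_U * Real.log X ≤ C_U * (1 / (8 * C_U) * X) := h
          _ = X / 8 := by field_simp
      linarith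
    · rw [Real.norm_eq_abs, Real.norm_eq_abs, id, abs_of_nonneg (by linarith),
        abs_of_nonneg (by linarith)] at hlin32X
      linarith
    · have h3 : Real.log (Real.log X) ^ (3 : ℝ) = Real.log (Real.log X) ^ (3 : ℕ) := by
        rw [show (3 : ℝ) = ((3 : ℕ) : ℝ) by norm_num, Real.rpow_natCast]
      rw [Real.norm_eq_abs, Real.norm_eq_abs, h3, Real.rpow_one,
        abs_of_nonneg (by positivity), abs_of_nonneg (by linarith)] at hcubeX
      linarith
  exact tendsto_natCast_atTop_atTop.eventually hreal

/-- `16 ≤ log y ≤ log x` and `log x/(2 log₂ x) ≤ log y`. [cite: Maynard2016LargeGaps, (2.1)] -/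
private theorem logy_facts {ε : ℝ} {x : ℕ} (hε0 : 0 < ε) (hε : ε < 1 / 2)
    (hL : 1 ≤ Real.log x) (hL₂ : 4 ≤ Real.log (Real.log x))
    (h32 : Real.log (Real.log x) ≤ Real.log x / 32) :
    16 ≤ Real.log (y ε x) ∧ Real.log (y ε x) ≤ Real.log x ∧
      Real.log x / (2 * Real.log (Real.log x)) ≤ Real.log (y ε x) := by
  have hL0 : 0 < Real.log (x : ℝ) := lt_of_lt_of_le one_pos hL
  have hL₂0 : 0 < Real.log (Real.log (x : ℝ)) := by linarith
  have hL₃le : Real.log (Real.log (Real.log (x : ℝ))) ≤ Real.log (Real.log x) :=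
    (Real.log_le_sub_one_of_pos hL₂0).trans (by linarith)
  have hL₃1 : 1 ≤ Real.log (Real.log (Real.log (x : ℝ))) := by
    have he4 : Real.exp 1 ≤ 4 := by have := Real.exp_one_lt_d9; linarith
    have h1 : (1 : ℝ) ≤ Real.log 4 := by
      have := Real.log_le_log (Real.exp_pos 1) he4; rwa [Real.log_exp] at this
    exact h1.trans (Real.log_le_log (by norm_num) hL₂)
  set T := Real.log (x : ℝ) * Real.log (Real.log (Real.log x)) / Real.log (Real.log x) with hT
  have hT32 : 32 ≤ T := by
    rw [hT, le_div_iff₀ hL₂0]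
    have h1 : 32 * Real.log (Real.log (x : ℝ)) ≤ Real.log x := by linarith
    calc 32 * Real.log (Real.log (x : ℝ)) ≤ Real.log x := h1
      _ ≤ Real.log x * Real.log (Real.log (Real.log x)) := le_mul_of_one_le_right hL0.le hL₃1
  have hTle : T ≤ Real.log x := by
    rw [hT, div_le_iff₀ hL₂0]
    exact mul_le_mul_of_nonneg_left hL₃le hL0.le
  have hTge : Real.log (x : ℝ) / Real.log (Real.log x) ≤ T := by
    rw [hT]
    exact div_le_div_of_nonneg_right (le_mul_of_one_le_right hL0.le hL₃1) hL₂0.le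
  have hly : Real.log (y ε x) = (1 - ε) * T := by rw [log_y]
  have hT0 : 0 ≤ T := by linarith
  refine ⟨?_, ?_, ?_⟩
  · rw [hly]; nlinarith
  · rw [hly]; nlinarith
  · rw [hly]
    have h1 : Real.log (x : ℝ) / (2 * Real.log (Real.log x)) =
        (1 / 2) * (Real.log (x : ℝ) / Real.log (Real.log x)) := by
      rw [mul_comm 2, ← div_div]; ring
    rw [h1]
    have h2 : (1 / 2 : ℝ) * (Real.log (x : ℝ) / Real.log (Real.log x)) ≤ (1 / 2) * T :=
      mul_le_mul_of_nonneg_left hTge (by norm_num)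
    have h3 : (1 / 2 : ℝ) * T ≤ (1 - ε) * T := mul_le_mul_of_nonneg_right (by linarith) hT0
    linarith

/-- `⌊y⌋ ≥ 2`, and Mertens: `P_y ≤ 12/log y` once `log y ≥ 16`.
[cite: HardyWright2008, Thm 429; Maynard2016LargeGaps, §2, Lemma 3] -/
private theorem floor_y_facts {ε : ℝ} {x : ℕ} (hly : 16 ≤ Real.log (y ε x)) :
    2 ≤ ⌊y ε x⌋₊ ∧ oddPrimeProd ⌊y ε x⌋₊ ≤ 12 / Real.log (y ε x) := by
  have hy0 : 0 < y ε x := Real.exp_pos _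
  have hyexp : Real.exp 16 ≤ y ε x := by
    have := Real.exp_le_exp.2 hly; rwa [Real.exp_log hy0] at this
  have he16 : Real.exp 12 + 1 ≤ Real.exp 16 := by
    have h1 : Real.exp 16 = Real.exp 12 * Real.exp 4 := by rw [← Real.exp_add]; norm_num
    have h2 : (2 : ℝ) ≤ Real.exp 4 := by have := Real.add_one_le_exp (4 : ℝ); linarith
    have h3 : (1 : ℝ) ≤ Real.exp 12 := by have := Real.add_one_le_exp (12 : ℝ); linarith
    nlinarith
  have hYfloor : y ε x - 1 < (⌊y ε x⌋₊ : ℝ) := by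
    have := Nat.lt_floor_add_one (y ε x); linarith
  have hY12 : Real.exp 12 ≤ (⌊y ε x⌋₊ : ℝ) := by linarith
  have hy2 : (2 : ℝ) ≤ y ε x := by
    have := Real.add_one_le_exp (16 : ℝ); linarith
  have hY2 : 2 ≤ ⌊y ε x⌋₊ := Nat.le_floor (by exact_mod_cast hy2)
  have hYhalf : y ε x / 2 ≤ (⌊y ε x⌋₊ : ℝ) := by linarith
  have hlogY : Real.log (y ε x) / 2 ≤ Real.log (⌊y ε x⌋₊ : ℝ) := by
    have h1 := Real.log_le_log (by positivity) hYhalf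
    rw [Real.log_div hy0.ne' two_ne_zero] at h1
    have h2 : Real.log 2 < 1 := by have := Real.log_two_lt_d9; norm_num at this; linarith
    linarith
  refine ⟨hY2, (oddPrimeProd_le hY12).trans ?_⟩
  have hly0 : 0 < Real.log (y ε x) := by linarith
  calc 6 / Real.log (⌊y ε x⌋₊ : ℝ) ≤ 6 / (Real.log (y ε x) / 2) :=
        div_le_div_of_nonneg_left (by norm_num) (by positivity) hlogY
    _ = 12 / Real.log (y ε x) := by field_simp; ring

/-- `K e^{−√(log₂ x)} ≤ 1` once `log₂ x ≥ (log K)²`. [folklore] -/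
private theorem kappa_le_one {K t : ℝ} (hK : 0 < K) (ht : Real.log K ^ 2 ≤ t) :
    K * Real.exp (-t ^ ((1 : ℝ) / 2)) ≤ 1 := by
  have ht0 : 0 ≤ t := le_trans (sq_nonneg _) ht
  have hsq : Real.log K ≤ t ^ ((1 : ℝ) / 2) := by
    rw [← Real.sqrt_eq_rpow]
    rcases le_or_gt (Real.log K) 0 with hneg | hpos
    · exact hneg.trans (Real.sqrt_nonneg _)
    · calc Real.log K = Real.sqrt (Real.log K ^ 2) := (Real.sqrt_sq hpos.le).symm
        _ ≤ Real.sqrt t := Real.sqrt_le_sqrt ht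
  have h1 : K ≤ Real.exp (t ^ ((1 : ℝ) / 2)) := by
    calc K = Real.exp (Real.log K) := (Real.exp_log hK).symm
      _ ≤ _ := Real.exp_le_exp.2 hsq
  calc K * Real.exp (-t ^ ((1 : ℝ) / 2))
      ≤ Real.exp (t ^ ((1 : ℝ) / 2)) * Real.exp (-t ^ ((1 : ℝ) / 2)) :=
        mul_le_mul_of_nonneg_right h1 (Real.exp_pos _).le
    _ = 1 := by rw [← Real.exp_add, add_neg_cancel, Real.exp_zero]

/-- Sizes of `U`, `z`, `⌈U/z⌉`, and `U z⁻¹ (log₂ x)⁻² ≥ 1`. [cite: Maynard2016LargeGaps, (2.1)] -/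
private theorem Uz_facts {C_U ε : ℝ} {x : ℕ} (hC : 0 < C_U) (hx8 : 8 ≤ (x : ℝ))
    (hL : 1 ≤ Real.log x) (hL₂ : 4 ≤ Real.log (Real.log x)) (hlogC : C_U ≤ Real.log x)
    (hlinx : C_U * Real.log x + 1 ≤ (x : ℝ) / 4)
    (hcube : 2 * Real.log (Real.log x) ^ 3 ≤ C_U * Real.log x)
    (hly0 : 0 < Real.log (y ε x)) (hlyL : Real.log (y ε x) ≤ Real.log x)
    (hlyhalf : Real.log x / (2 * Real.log (Real.log x)) ≤ Real.log (y ε x)) :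
    0 ≤ z x ∧ 0 ≤ U C_U ε x ∧ U C_U ε x ≤ (x : ℝ) * Real.log x ^ 2 ∧
      z x + z x / Real.log x ≤ (x : ℝ) * Real.log x ^ 2 ∧
      ⌈U C_U ε x / z x⌉₊ ≤ x ∧ 1 ≤ U C_U ε x / (z x * Real.log (Real.log x) ^ 2) := by
  have hx0 : (0 : ℝ) < x := by linarith
  have hL0 : 0 < Real.log (x : ℝ) := by linarith
  have hL₂0 : 0 < Real.log (Real.log (x : ℝ)) := by linarith
  have hz0 : 0 < z x := by rw [z]; positivity
  have hU0 : 0 ≤ U C_U ε x := by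
    rw [U]; exact mul_nonneg hC.le (div_nonneg (mul_nonneg hx0.le hly0.le) hL₂0.le)
  have hUle : U C_U ε x ≤ (x : ℝ) * Real.log x ^ 2 := by
    rw [U]
    have h1 : (x : ℝ) * Real.log (y ε x) / Real.log (Real.log x) ≤ (x : ℝ) * Real.log x := by
      rw [div_le_iff₀ hL₂0]
      have h2 : (x : ℝ) * Real.log (y ε x) ≤ (x : ℝ) * Real.log x :=
        mul_le_mul_of_nonneg_left hlyL hx0.le
      exact h2.trans (le_mul_of_one_le_right (by positivity) (by linarith))
    calc C_U * ((x : ℝ) * Real.log (y ε x) / Real.log (Real.log x))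
        ≤ C_U * ((x : ℝ) * Real.log x) := mul_le_mul_of_nonneg_left h1 hC.le
      _ ≤ Real.log x * ((x : ℝ) * Real.log x) := mul_le_mul_of_nonneg_right hlogC (by positivity)
      _ = (x : ℝ) * Real.log x ^ 2 := by ring
  have hV₀ : z x + z x / Real.log x ≤ (x : ℝ) * Real.log x ^ 2 := by
    have h1 : z x / Real.log x ≤ z x := div_le_self hz0.le hL
    have h2 : z x ≤ (x : ℝ) / 2 := by
      rw [z]; exact div_le_div_of_nonneg_left hx0.le two_pos (by linarith)
    have h3 : (x : ℝ) ≤ (x : ℝ) * Real.log x ^ 2 := le_mul_of_one_le_right hx0.le (by nlinarith)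
    linarith
  have hUz : U C_U ε x / z x = C_U * Real.log (y ε x) := by
    rw [U, z]; field_simp
  have hB : ⌈U C_U ε x / z x⌉₊ ≤ x := by
    have h1 : (⌈U C_U ε x / z x⌉₊ : ℝ) < U C_U ε x / z x + 1 := Nat.ceil_lt_add_one (by positivity)
    have h2 : U C_U ε x / z x ≤ C_U * Real.log x := by
      rw [hUz]; exact mul_le_mul_of_nonneg_left hlyL hC.le
    have h3 : (⌈U C_U ε x / z x⌉₊ : ℝ) ≤ x := by linarith
    exact_mod_cast h3
  have hWeq : U C_U ε x / (z x * Real.log (Real.log x) ^ 2) =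
      C_U * Real.log (y ε x) / Real.log (Real.log x) ^ 2 := by
    rw [U, z]; field_simp
  have hW1 : 1 ≤ U C_U ε x / (z x * Real.log (Real.log x) ^ 2) := by
    rw [hWeq, le_div_iff₀ (by positivity), one_mul]
    have h1 : Real.log (Real.log (x : ℝ)) ^ 2 ≤ C_U * (Real.log (x : ℝ) / (2 * Real.log (Real.log x))) := by
      rw [mul_div_assoc', le_div_iff₀ (by positivity)]
      have : Real.log (Real.log (x : ℝ)) ^ 2 * (2 * Real.log (Real.log x)) =
          2 * Real.log (Real.log x) ^ 3 := by ring
      linarith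
    exact h1.trans (mul_le_mul_of_nonneg_left hlyhalf hC.le)
  exact ⟨hz0.le, hU0, hUle, hV₀, hB, hW1⟩

/-- The sizes of `y, z, U, ⌈U/z⌉, U z⁻¹(log₂ x)⁻²`, Mertens for `P_y`, and `K e^{−√log₂ x} ≤ 1`, for
all large `x`. [cite: Maynard2016LargeGaps, (2.1) and §2, proof of Lemma 4] -/
private theorem eventually_facts {C_U ε K : ℝ} (hC : 0 < C_U) (hε0 : 0 < ε) (hε : ε < 1 / 2)
    (hK : 0 < K) :
    ∀ᶠ x : ℕ in atTop,
      1 ≤ Real.log x ∧ 1 ≤ Real.log (Real.log x) ∧ 0 ≤ Real.log (Real.log (Real.log x)) ∧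
      2 ≤ Real.log (y ε x) ∧ Real.log (y ε x) ≤ Real.log x ∧
      2 ≤ ⌊y ε x⌋₊ ∧ oddPrimeProd ⌊y ε x⌋₊ ≤ 12 / Real.log (y ε x) ∧
      0 ≤ K * Real.exp (-(Real.log (Real.log x)) ^ ((1 : ℝ) / 2)) ∧
      K * Real.exp (-(Real.log (Real.log x)) ^ ((1 : ℝ) / 2)) ≤ 1 ∧
      0 ≤ z x ∧ 0 ≤ U C_U ε x ∧ U C_U ε x ≤ (x : ℝ) * Real.log x ^ 2 ∧
      z x + z x / Real.log x ≤ (x : ℝ) * Real.log x ^ 2 ∧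
      ⌈U C_U ε x / z x⌉₊ ≤ x ∧
      1 ≤ U C_U ε x / (z x * Real.log (Real.log x) ^ 2) := by
  filter_upwards [eventually_logs (K := K) hC] with x hx
  obtain ⟨hlog1, h4, hK2, hlogC, hx8, hlinx, h32, hcube3⟩ := hx
  obtain ⟨hly16, hlyL, hlyhalf⟩ := logy_facts hε0 hε hlog1 h4 h32
  obtain ⟨hY2, hP⟩ := floor_y_facts hly16
  have hly0 : 0 < Real.log (y ε x) := by linarith
  obtain ⟨hz0, hU0, hUle, hV₀, hB, hW1⟩ :=
    Uz_facts (ε := ε) hC hx8 hlog1 h4 hlogC hlinx hcube3 hly0 hlyL hlyhalf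
  have hL₃0 : 0 ≤ Real.log (Real.log (Real.log (x : ℝ))) :=
    Real.log_nonneg (by linarith)
  exact ⟨hlog1, by linarith, hL₃0, by linarith, hlyL, hY2, hP, by positivity,
    kappa_le_one hK hK2, hz0, hU0, hUle, hV₀, hB, hW1⟩

/-- `384 C_U (1 + log₃ x) ≤ η log₂ x` for all large `x` (`log₃ x = o(log₂ x)`). [folklore] -/
private theorem eventually_tail_ratio {C_U η : ℝ} (hC : 0 < C_U) (hη : 0 < η) :
    ∀ᶠ x : ℕ in atTop,
      384 * C_U * (1 + Real.log (Real.log (Real.log x))) ≤ η * Real.log (Real.log x) := by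
  have hT₂ : Tendsto (fun X : ℝ => Real.log (Real.log X)) atTop atTop :=
    Real.tendsto_log_atTop.comp Real.tendsto_log_atTop
  have hc : (0 : ℝ) < η / (768 * C_U) := by positivity
  have hlin := hT₂.eventually (Real.isLittleO_log_id_atTop.bound hc)
  have hreal : ∀ᶠ X : ℝ in atTop,
      384 * C_U * (1 + Real.log (Real.log (Real.log X))) ≤ η * Real.log (Real.log X) := by
    filter_upwards [hlin, hT₂.eventually_ge_atTop (768 * C_U / η), hT₂.eventually_ge_atTop 4]
      with X hlinX hbig h4
    rw [Real.norm_eq_abs, Real.norm_eq_abs, id,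
      abs_of_nonneg (show (0 : ℝ) ≤ Real.log (Real.log X) by linarith)] at hlinX
    have h1 : Real.log (Real.log (Real.log X)) ≤ η / (768 * C_U) * Real.log (Real.log X) :=
      (le_abs_self _).trans hlinX
    have h2 : 1 ≤ η / (768 * C_U) * Real.log (Real.log X) := by
      rw [div_mul_eq_mul_div, le_div_iff₀ (by positivity)]
      rw [div_le_iff₀ hη] at hbig
      linarith
    have h3 : 384 * C_U * (1 + Real.log (Real.log (Real.log X))) ≤
        384 * C_U * (2 * (η / (768 * C_U) * Real.log (Real.log X))) :=
      mul_le_mul_of_nonneg_left (by linarith) (by positivity)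
    calc _ ≤ _ := h3
      _ = η * Real.log (Real.log X) := by field_simp; ring
  exact tendsto_natCast_atTop_atTop.eventually hreal

/-! ### The two ranges -/

/-- Common algebra: with `Q = C_U x/(log₂ x log x)`, `2 P_y U/log x ≤ 24 Q` and
`4 P_y z B'/log² x ≤ 96 Q/log x` for `B' ≤ 2 C_U log y`. [cite: Maynard2016LargeGaps, §2, proof of
Lemma 4] -/
private theorem coeff_bounds {C_U ε : ℝ} {x : ℕ} {B' : ℝ} (hC : 0 < C_U) (hx0 : (0 : ℝ) < x)
    (hL : 1 ≤ Real.log x) (hL₂ : 1 ≤ Real.log (Real.log x)) (hly : 2 ≤ Real.log (y ε x))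
    (hP : oddPrimeProd ⌊y ε x⌋₊ ≤ 12 / Real.log (y ε x)) (hB' : B' ≤ 2 * C_U * Real.log (y ε x)) :
    2 * oddPrimeProd ⌊y ε x⌋₊ * U C_U ε x / Real.log x ≤
        24 * (C_U * x / (Real.log (Real.log x) * Real.log x)) ∧
      4 * oddPrimeProd ⌊y ε x⌋₊ * z x * B' / Real.log x ^ 2 ≤
        96 * (C_U * x / (Real.log (Real.log x) * Real.log x)) := by
  have hP0 := (oddPrimeProd_pos ⌊y ε x⌋₊).le
  have hly0 : 0 < Real.log (y ε x) := by linarith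
  have hL0 : 0 < Real.log (x : ℝ) := by linarith
  have hL₂0 : 0 < Real.log (Real.log (x : ℝ)) := by linarith
  have hPly : oddPrimeProd ⌊y ε x⌋₊ * Real.log (y ε x) ≤ 12 := by
    rwa [le_div_iff₀ hly0] at hP
  have hQ0 : 0 ≤ C_U * x / (Real.log (Real.log x) * Real.log x) := by positivity
  constructor
  · have h1 : 2 * oddPrimeProd ⌊y ε x⌋₊ * U C_U ε x / Real.log x =
        2 * (oddPrimeProd ⌊y ε x⌋₊ * Real.log (y ε x)) *
          (C_U * x / (Real.log (Real.log x) * Real.log x)) := by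
      rw [U]; field_simp
    rw [h1]
    have := mul_le_mul_of_nonneg_right hPly hQ0
    nlinarith
  · have h1 : 4 * oddPrimeProd ⌊y ε x⌋₊ * z x * B' / Real.log x ^ 2 ≤
        4 * oddPrimeProd ⌊y ε x⌋₊ * z x * (2 * C_U * Real.log (y ε x)) / Real.log x ^ 2 := by
      apply div_le_div_of_nonneg_right _ (by positivity)
      have hz0 : 0 ≤ z x := by rw [z]; positivity
      exact mul_le_mul_of_nonneg_left hB' (by positivity)
    have h2 : 4 * oddPrimeProd ⌊y ε x⌋₊ * z x * (2 * C_U * Real.log (y ε x)) / Real.log x ^ 2 =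
        8 * (oddPrimeProd ⌊y ε x⌋₊ * Real.log (y ε x)) *
          (C_U * x / (Real.log (Real.log x) * Real.log x)) / Real.log x := by
      rw [z]; field_simp; ring
    have h3 : 8 * (oddPrimeProd ⌊y ε x⌋₊ * Real.log (y ε x)) *
          (C_U * x / (Real.log (Real.log x) * Real.log x)) / Real.log x ≤
        96 * (C_U * x / (Real.log (Real.log x) * Real.log x)) / Real.log x := by
      apply div_le_div_of_nonneg_right _ hL0.le
      have := mul_le_mul_of_nonneg_right hPly hQ0
      nlinarith
    have h4 : 96 * (C_U * x / (Real.log (Real.log x) * Real.log x)) / Real.log x ≤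
        96 * (C_U * x / (Real.log (Real.log x) * Real.log x)) := div_le_self (by positivity) hL
    linarith

/-- **Tail range** `U z⁻¹(log₂x)⁻² ≤ m < U/z`: `Σ |𝓡_m| ≤ 384 C_U (1 + log₃ x)/log₂ x · x/log x ≤
η x/log x`. [cite: Maynard2016LargeGaps, §2, Lemma 4 (first bound)] -/
private theorem tail_core {C_U ε κ η : ℝ} {x : ℕ} (hC : 0 < C_U) (hκ0 : 0 ≤ κ) (hκ : κ ≤ 1)
    (hL : 1 ≤ Real.log x) (hL₂ : 1 ≤ Real.log (Real.log x))
    (hL₃ : 0 ≤ Real.log (Real.log (Real.log x)))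
    (hly : 2 ≤ Real.log (y ε x)) (hY : 2 ≤ ⌊y ε x⌋₊)
    (hP : oddPrimeProd ⌊y ε x⌋₊ ≤ 12 / Real.log (y ε x)) (hz0 : 0 ≤ z x) (hU0 : 0 ≤ U C_U ε x)
    (hUx : U C_U ε x ≤ (x : ℝ) * Real.log x ^ 2)
    (hV₀x : z x + z x / Real.log x ≤ (x : ℝ) * Real.log x ^ 2)
    (hBx : ⌈U C_U ε x / z x⌉₊ ≤ x) (hW1 : 1 ≤ U C_U ε x / (z x * Real.log (Real.log x) ^ 2))
    (hη : 384 * C_U * (1 + Real.log (Real.log (Real.log x))) ≤ η * Real.log (Real.log x))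
    (hL3 : ∀ V : ℝ, z x + z x / Real.log x ≤ V → V ≤ (x : ℝ) * Real.log x ^ 2 →
      ∀ m : ℕ, 1 ≤ m → m ≤ x →
        |((sievedPrimes ε x V m).card : ℝ) - (V - z x) / Real.log x * singProd ε x m| ≤
          κ * ((V - z x) / Real.log x * singProd ε x m)) :
    (∑ m ∈ (Finset.range ⌈U C_U ε x / z x⌉₊).filter
        (fun m : ℕ => U C_U ε x / (z x * (Real.log (Real.log x)) ^ 2) ≤ m),
      ((Rm C_U ε x m).card : ℝ)) ≤ η * ((x : ℝ) / Real.log x) := by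
  have hx0 : (0 : ℝ) < x := by
    rcases Nat.eq_zero_or_pos x with h | h
    · subst h; norm_num at hL
    · exact_mod_cast h
  have hL0 : 0 < Real.log (x : ℝ) := by linarith
  have hL₂0 : 0 < Real.log (Real.log (x : ℝ)) := by linarith
  have hly0 : 0 < Real.log (y ε x) := by linarith
  have hzpos : 0 < z x := by rw [z]; positivity
  have hUz : U C_U ε x / z x = C_U * Real.log (y ε x) := by rw [U, z]; field_simp
  have hWeq : U C_U ε x / (z x * Real.log (Real.log x) ^ 2) =
      C_U * Real.log (y ε x) / Real.log (Real.log x) ^ 2 := by rw [U, z]; field_simp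
  set W := U C_U ε x / (z x * Real.log (Real.log x) ^ 2) with hWdef
  have hW0 : 0 < W := by linarith
  have hWle : W ≤ C_U * Real.log (y ε x) := by
    rw [hWeq]; exact div_le_self (by positivity) (by nlinarith)
  set A := ⌈W⌉₊ with hA
  set B := ⌈U C_U ε x / z x⌉₊ with hB
  have hA1 : 1 ≤ A := Nat.ceil_pos.2 hW0
  have hAB : A ≤ B := Nat.ceil_mono (by rw [hUz]; exact hWle)
  have hS : (Finset.range B).filter (fun m : ℕ => W ≤ m) ⊆ Finset.Ico A B := by
    intro m hm
    rw [mem_filter, mem_range] at hm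
    rw [mem_Ico]
    exact ⟨Nat.ceil_le.2 hm.2, hm.1⟩
  have hmain := sum_card_Rm_le _ hS hA1 hAB hBx hκ0 hκ hz0 hL0 hU0 hY hUx hV₀x hL3
  -- sizes of `A`, `B`
  have hCly1 : 1 ≤ C_U * Real.log (y ε x) := hW1.trans hWle
  have hBr : (B : ℝ) ≤ 2 * C_U * Real.log (y ε x) := by
    have h1 : (B : ℝ) < U C_U ε x / z x + 1 := Nat.ceil_lt_add_one (by positivity)
    rw [hUz] at h1; linarith
  have hB1 : (1 : ℝ) ≤ B := by exact_mod_cast hA1.trans hAB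
  have hAr : W ≤ (A : ℝ) := Nat.le_ceil W
  have hlogBA : Real.log B - Real.log A ≤ Real.log 2 + 2 * Real.log (Real.log (Real.log x)) := by
    have h1 : Real.log (B : ℝ) ≤ Real.log (2 * (C_U * Real.log (y ε x))) :=
      Real.log_le_log (by linarith) (by linarith)
    have h2 : Real.log W ≤ Real.log (A : ℝ) := Real.log_le_log hW0 hAr
    have h3 : Real.log (2 * (C_U * Real.log (y ε x))) = Real.log 2 + Real.log (C_U * Real.log (y ε x)) :=
      Real.log_mul two_ne_zero (by positivity)
    have h4 : Real.log W = Real.log (C_U * Real.log (y ε x)) - 2 * Real.log (Real.log (Real.log x)) := by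
      rw [hWeq, Real.log_div (by positivity) (by positivity), Real.log_pow]; ring
    linarith
  have hlog2 : (1 : ℝ) / 2 < Real.log 2 := by have := Real.log_two_gt_d9; linarith
  have hF : 4 * (Real.log B - Real.log A) / Real.log 2 + 4 ≤
      12 + 16 * Real.log (Real.log (Real.log x)) := by
    have h1 : 4 * (Real.log B - Real.log A) / Real.log 2 ≤
        4 * (Real.log 2 + 2 * Real.log (Real.log (Real.log x))) / Real.log 2 :=
      div_le_div_of_nonneg_right (by linarith) (by linarith)
    have h2 : 4 * (Real.log 2 + 2 * Real.log (Real.log (Real.log x))) / Real.log 2 =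
        4 + 8 * Real.log (Real.log (Real.log x)) / Real.log 2 := by
      field_simp; ring
    have h3 : 8 * Real.log (Real.log (Real.log x)) / Real.log 2 ≤
        16 * Real.log (Real.log (Real.log x)) := by
      rw [div_le_iff₀ (by linarith)]; nlinarith
    linarith
  obtain ⟨hc1, hc2⟩ := coeff_bounds (ε := ε) hC hx0 hL hL₂ hly hP hBr
  set Q := C_U * x / (Real.log (Real.log x) * Real.log x) with hQ
  have hQ0 : 0 ≤ Q := by positivity
  have hP0 := (oddPrimeProd_pos ⌊y ε x⌋₊).le
  have hT1 : 2 * oddPrimeProd ⌊y ε x⌋₊ * U C_U ε x / Real.log x *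
      (4 * (Real.log B - Real.log A) / Real.log 2 + 4) ≤
        24 * Q * (12 + 16 * Real.log (Real.log (Real.log x))) := by
    have ha : 0 ≤ 2 * oddPrimeProd ⌊y ε x⌋₊ * U C_U ε x / Real.log x := by positivity
    calc _ ≤ 2 * oddPrimeProd ⌊y ε x⌋₊ * U C_U ε x / Real.log x *
          (12 + 16 * Real.log (Real.log (Real.log x))) := mul_le_mul_of_nonneg_left hF ha
      _ ≤ _ := mul_le_mul_of_nonneg_right hc1 (by positivity)
  have htot : 24 * Q * (12 + 16 * Real.log (Real.log (Real.log x))) + 96 * Q ≤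
      η * ((x : ℝ) / Real.log x) := by
    have h1 : 24 * Q * (12 + 16 * Real.log (Real.log (Real.log x))) + 96 * Q =
        (384 * C_U * (1 + Real.log (Real.log (Real.log x))) / Real.log (Real.log x)) *
          ((x : ℝ) / Real.log x) := by
      rw [hQ]; field_simp; ring
    rw [h1]
    apply mul_le_mul_of_nonneg_right _ (by positivity)
    rw [div_le_iff₀ hL₂0]; exact hη
  linarith

/-- **Head range** `1 ≤ m < U z⁻¹(log₂x)⁻²`: `Σ |𝓡_m| ≤ (576 + 192|log C_U|) C_U x/log x`.
[cite: Maynard2016LargeGaps, §2, Lemma 4 (second bound)] -/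
private theorem head_core {C_U ε κ : ℝ} {x : ℕ} (hC : 0 < C_U) (hκ0 : 0 ≤ κ) (hκ : κ ≤ 1)
    (hL : 1 ≤ Real.log x) (hL₂ : 1 ≤ Real.log (Real.log x))
    (hly : 2 ≤ Real.log (y ε x)) (hlyL : Real.log (y ε x) ≤ Real.log x) (hY : 2 ≤ ⌊y ε x⌋₊)
    (hP : oddPrimeProd ⌊y ε x⌋₊ ≤ 12 / Real.log (y ε x)) (hz0 : 0 ≤ z x) (hU0 : 0 ≤ U C_U ε x)
    (hUx : U C_U ε x ≤ (x : ℝ) * Real.log x ^ 2)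
    (hV₀x : z x + z x / Real.log x ≤ (x : ℝ) * Real.log x ^ 2)
    (hBx : ⌈U C_U ε x / z x⌉₊ ≤ x) (hW1 : 1 ≤ U C_U ε x / (z x * Real.log (Real.log x) ^ 2))
    (hL3 : ∀ V : ℝ, z x + z x / Real.log x ≤ V → V ≤ (x : ℝ) * Real.log x ^ 2 →
      ∀ m : ℕ, 1 ≤ m → m ≤ x →
        |((sievedPrimes ε x V m).card : ℝ) - (V - z x) / Real.log x * singProd ε x m| ≤
          κ * ((V - z x) / Real.log x * singProd ε x m)) :
    (∑ m ∈ (Finset.range ⌈U C_U ε x / (z x * (Real.log (Real.log x)) ^ 2)⌉₊).filter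
        (fun m : ℕ => 1 ≤ m), ((Rm C_U ε x m).card : ℝ)) ≤
      (576 + 192 * |Real.log C_U|) * (C_U * (x : ℝ) / Real.log x) := by
  have hx0 : (0 : ℝ) < x := by
    rcases Nat.eq_zero_or_pos x with h | h
    · subst h; norm_num at hL
    · exact_mod_cast h
  have hL0 : 0 < Real.log (x : ℝ) := by linarith
  have hL₂0 : 0 < Real.log (Real.log (x : ℝ)) := by linarith
  have hly0 : 0 < Real.log (y ε x) := by linarith
  have hzpos : 0 < z x := by rw [z]; positivity
  have hUz : U C_U ε x / z x = C_U * Real.log (y ε x) := by rw [U, z]; field_simp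
  have hWeq : U C_U ε x / (z x * Real.log (Real.log x) ^ 2) =
      C_U * Real.log (y ε x) / Real.log (Real.log x) ^ 2 := by rw [U, z]; field_simp
  set W := U C_U ε x / (z x * Real.log (Real.log x) ^ 2) with hWdef
  have hW0 : 0 < W := by linarith
  have hWle : W ≤ C_U * Real.log (y ε x) := by
    rw [hWeq]; exact div_le_self (by positivity) (by nlinarith)
  set A := ⌈W⌉₊ with hA
  have hA1 : 1 ≤ A := Nat.ceil_pos.2 hW0
  have hAB : A ≤ ⌈U C_U ε x / z x⌉₊ := Nat.ceil_mono (by rw [hUz]; exact hWle)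
  have hAx : A ≤ x := hAB.trans hBx
  have hS : (Finset.range A).filter (fun m : ℕ => 1 ≤ m) ⊆ Finset.Ico 1 A := by
    intro m hm
    rw [mem_filter, mem_range] at hm
    rw [mem_Ico]
    exact ⟨hm.2, hm.1⟩
  have hmain := sum_card_Rm_le _ hS le_rfl hA1 hAx hκ0 hκ hz0 hL0 hU0 hY hUx hV₀x hL3
  have hAr : (A : ℝ) ≤ 2 * C_U * Real.log (y ε x) := by
    have h1 : (A : ℝ) < W + 1 := Nat.ceil_lt_add_one hW0.le
    have hCly1 : 1 ≤ C_U * Real.log (y ε x) := hW1.trans hWle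
    linarith
  have hA1r : (1 : ℝ) ≤ A := by exact_mod_cast hA1
  have hlogA : Real.log A ≤ 1 + |Real.log C_U| + Real.log (Real.log x) := by
    have h1 : Real.log (A : ℝ) ≤ Real.log (2 * (C_U * Real.log (y ε x))) :=
      Real.log_le_log (by linarith) (by linarith)
    have h2 : Real.log (2 * (C_U * Real.log (y ε x))) =
        Real.log 2 + Real.log C_U + Real.log (Real.log (y ε x)) := by
      rw [Real.log_mul two_ne_zero (by positivity), Real.log_mul hC.ne' hly0.ne']; ring
    have h3 : Real.log (Real.log (y ε x)) ≤ Real.log (Real.log x) := Real.log_le_log hly0 hlyL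
    have h4 : Real.log 2 < 1 := by have := Real.log_two_lt_d9; norm_num at this; linarith
    have h5 : Real.log C_U ≤ |Real.log C_U| := le_abs_self _
    linarith
  have hlog2 : (1 : ℝ) / 2 < Real.log 2 := by have := Real.log_two_gt_d9; linarith
  have hlogA0 : 0 ≤ Real.log (A : ℝ) := Real.log_nonneg hA1r
  have hF : 4 * (Real.log A - Real.log (1 : ℕ)) / Real.log 2 + 4 ≤
      12 + 8 * |Real.log C_U| + 8 * Real.log (Real.log x) := by
    rw [Nat.cast_one, Real.log_one, sub_zero]
    have h1 : 4 * Real.log (A : ℝ) / Real.log 2 ≤ 8 * Real.log A := by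
      rw [div_le_iff₀ (by linarith)]; nlinarith
    nlinarith [abs_nonneg (Real.log C_U)]
  obtain ⟨hc1, hc2⟩ := coeff_bounds (ε := ε) hC hx0 hL hL₂ hly hP hAr
  set Q := C_U * x / (Real.log (Real.log x) * Real.log x) with hQ
  set R := C_U * (x : ℝ) / Real.log x with hR
  have hQ0 : 0 ≤ Q := by positivity
  have hR0 : 0 ≤ R := by positivity
  have hQR : Q * Real.log (Real.log x) = R := by rw [hQ, hR]; field_simp
  have hQleR : Q ≤ R := by
    rw [← hQR]; exact le_mul_of_one_le_right hQ0 hL₂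
  have hP0 := (oddPrimeProd_pos ⌊y ε x⌋₊).le
  have hT1 : 2 * oddPrimeProd ⌊y ε x⌋₊ * U C_U ε x / Real.log x *
      (4 * (Real.log A - Real.log (1 : ℕ)) / Real.log 2 + 4) ≤
        24 * Q * (12 + 8 * |Real.log C_U| + 8 * Real.log (Real.log x)) := by
    have ha : 0 ≤ 2 * oddPrimeProd ⌊y ε x⌋₊ * U C_U ε x / Real.log x := by positivity
    calc _ ≤ 2 * oddPrimeProd ⌊y ε x⌋₊ * U C_U ε x / Real.log x *
          (12 + 8 * |Real.log C_U| + 8 * Real.log (Real.log x)) := mul_le_mul_of_nonneg_left hF ha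
      _ ≤ _ := mul_le_mul_of_nonneg_right hc1 (by positivity)
  have htot : 24 * Q * (12 + 8 * |Real.log C_U| + 8 * Real.log (Real.log x)) + 96 * Q ≤
      (576 + 192 * |Real.log C_U|) * R := by
    have h1 : 24 * Q * (12 + 8 * |Real.log C_U| + 8 * Real.log (Real.log x)) =
        24 * (Q * (12 + 8 * |Real.log C_U|)) + 192 * R := by rw [← hQR]; ring
    rw [h1]
    have h2 : Q * (12 + 8 * |Real.log C_U|) ≤ R * (12 + 8 * |Real.log C_U|) :=
      mul_le_mul_of_nonneg_right hQleR (by positivity)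
    nlinarith [abs_nonneg (Real.log C_U)]
  have hB1 : ((1 : ℕ) : ℝ) = 1 := Nat.cast_one
  linarith

/-! ### Lemma 4 from Lemma 3 -/

/-- **Maynard 2016, Lemma 4, PROVED from Lemma 3**: the typed named fact `Maynard2016.Lemma3`
(first display) implies the typed named fact `Maynard2016.Lemma4` (both "in particular" bounds),
via Mertens' theorem and `Σ_{A≤m<B} g(m)/m ≪ log(B/A) + 1`.
[cite: Maynard2016LargeGaps, §2, Lemma 4 («This follows from Lemma 3, and the bound …»)] -/
theorem lemma4_of_lemma3 (h3 : Literature.NumberTheory.Sieve.Maynard2016.Lemma3) :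
    Literature.NumberTheory.Sieve.Maynard2016.Lemma4 := by
  intro C_U hC
  have hε : ∀ᶠ ε : ℝ in 𝓝[>] (0 : ℝ), 0 < ε ∧ ε < 1 / 2 := by
    have h1 : ∀ᶠ ε : ℝ in 𝓝[>] (0 : ℝ), ε ∈ Set.Ioi (0 : ℝ) := eventually_mem_nhdsWithin
    have h2 : ∀ᶠ ε : ℝ in 𝓝[>] (0 : ℝ), ε < 1 / 2 :=
      (eventually_lt_nhds (by norm_num : (0 : ℝ) < 1 / 2)).filter_mono nhdsWithin_le_nhds
    exact (h1.and h2).mono fun ε h => ⟨h.1, h.2⟩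
  filter_upwards [h3, hε] with ε hK hε'
  obtain ⟨K, hK0, hx⟩ := hK
  have hF := eventually_facts hC hε'.1 hε'.2 hK0
  refine ⟨fun η hη => ?_, ⟨576 + 192 * |Real.log C_U|, by positivity, ?_⟩⟩
  · filter_upwards [hx, hF, eventually_tail_ratio hC hη] with x hL3x hFx hηx
    obtain ⟨hL, hL₂, hL₃, hly, -, hY, hP, hκ0, hκ1, hz0, hU0, hUx, hV₀x, hBx, hW1⟩ := hFx
    exact tail_core hC hκ0 hκ1 hL hL₂ hL₃ hly hY hP hz0 hU0 hUx hV₀x hBx hW1 hηx hL3x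
  · filter_upwards [hx, hF] with x hL3x hFx
    obtain ⟨hL, hL₂, -, hly, hlyL, hY, hP, hκ0, hκ1, hz0, hU0, hUx, hV₀x, hBx, hW1⟩ := hFx
    exact head_core hC hκ0 hκ1 hL hL₂ hly hlyL hY hP hz0 hU0 hUx hV₀x hBx hW1 hL3x

/-- Hence, with Lemma 2 and Proposition 5 as the only remaining inputs, Theorem 1.
[cite: Maynard2016LargeGaps, Thm 1] -/
example (h2 : Lemma2) (h3 : Lemma3) (h5 : Proposition5) : Maynard2016_theorem1 :=
  theorem1_of_coveringTheorem (reduction_holds h2 (lemma4_of_lemma3 h3) h5)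

end Maynard2016

end Literature.NumberTheory.Sieve
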